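import Summits.ResolutionOfSingularities.ResolutionOfSingularities.Theorems.RadicialJungCleanModelsNSChainExtraction
import Summits.ResolutionOfSingularities.ResolutionOfSingularities.Theorems.RadicialJungCleanModelsNSResidueChainsReadOff
import Summits.ResolutionOfSingularities.ResolutionOfSingularities.Theorems.RadicialJungCleanModelsNSResidueRegularize
import Summits.ResolutionOfSingularities.ResolutionOfSingularities.Theorems.RadicialJungCleanModelsNSResidueLocAtCentre
import Summits.ResolutionOfSingularities.ResolutionOfSingularities.Theorems.RadicialJungCleanModelsWeakEmbeddedLUDimLEThree
import Literature.AlgebraicGeometry.Resolution.TransversalHasSNCWith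
import Literature.AlgebraicGeometry.Resolution.TransversalUnionSNC
import Literature.AlgebraicGeometry.Resolution.BlowupsExistence
import Literature.AlgebraicGeometry.Resolution.ExcellentClosedSubschemes
import Literature.AlgebraicGeometry.Resolution.ExcellentRingsEssFiniteType
import Literature.AlgebraicGeometry.Resolution.ExcellentRingsFieldProofs
import Literature.AlgebraicGeometry.Resolution.CofinalityFromPrincipalization
import HarnessLib

/-!
# The residue-side DRIVER: `CossartJannsenSaito2020Embedded → ResidueChains` (CJS Thm. 1.4 localised along the residue valuation)

Route `RadicialJung`, crux `CleanModels` (stmt-ResolutionOfSingularities-15917), registered skeleton `Cruxes/CleanModels/Lines/Sketch.lean`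
rev 35 (sha16 de44649d8f729c3b), stub 7 `stub_cleanModelsDimGEFour`.  Explicit-unit seat `decomp-res-hand-2` g6 (structural hand).  Spec
`Cruxes/CleanModels/Lines/Sketch_hand2_g5_NS32_assembly_spec.lean` rev 4 (`def ResidueChains`), the ONE remaining non-kernel input of
✓ `localMonomialization_four_of_rankOne_of_residueChains` (`…NSRankOneReduction.lean`, hypothesis `hChains`).  OURS; structural bookkeeping,
counted 0; nothing here proves resolution of singularities in characteristic `p`.

`residueChains_of_cjs2020` — for `O ≤ O₁ ≠ K`, a finitely generated model `A ⊆ O` of `K/k` with `Frac A = K`, `dim A ≤ 4` and regular residue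
ring `A_𝔮/𝔭` (`𝔮`, `𝔭` the centres of `ν`, `ν₁`), and a finite set `W ⊆ A` of `ν₁`-units: the residue-side chain of COORDINATE local blowing ups
of `ρ(locAtCentre A O) ⊆ κ(O₁)` along `ν̄` ending in a regular local ring with a system of parameters in which the residues of the `w ∈ W` and
all the `z̄₀⁽ⁱ⁾` are `ν̄`-units times monomials — VERBATIM the hypothesis `hChains` of the assembly, from F-32 (`CossartJannsenSaito2020Embedded`,
CJS 2020 Thm. 1.4 with `B = ∅`).  Proof: `S := ρ(locAtCentre A O)` is an excellent regular local ring of dimension `≤ 3` dominated by `ν̄`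
(✓ `nonempty_quotCentre_ringEquiv_range`, ✓ `range_residue_locAtCentre`); CJS Thm. 1.4 for `V(∏ w̄) ⊂ Spec S` followed by the blow-up of the
regular strict transform (the book's proof of Cor. 1.5, as in ✓ `stub_cjs2020Cor15_of_embedded`) is a sequence of blow-ups in regular centres over
`V(∏ w̄)` with strict normal crossings total transform; ✓ `chain_of_isEmbeddedTransform` extracts the chain along `ν̄`, and
✓ `exists_germ_eq_isUnit_mul_prod_pow_of_isStrictNormalCrossingsDivisor` + ✓ `readOff_of_monomial_form` read off the final format.
[cite: CossartJannsenSaito2020, Thm. 1.4 and Cor. 1.5 (p. 7)] [cite: NovacoskiSpivakovsky2014, Thm. 1.2 and §3.2]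
-/

noncomputable section

set_option linter.dupNamespace false -- mandated namespace of this single-conjunct summit

open IsLocalRing AlgebraicGeometry CategoryTheory TopologicalSpace
open Literature.AlgebraicGeometry.Resolution

namespace Summit.ResolutionOfSingularities.ResolutionOfSingularities.Theorems.RadicialJung.CleanModels

open Scheme.IdealSheafData

/-- Transport of `IsRsopPart` for families given by elements of a field along an equality of the ambient subrings and of the families.
[folklore] -/
theorem isRsopPart_congr {F : Type} [Field F] {T T' : Subring F} (hT : T = T') {hT₁ : IsLocalRing T} {hT₂ : IsLocalRing T'}
    {m : ℕ} {c c' : Fin m → F} (hcc : c = c') (hc : ∀ j, c j ∈ T) (hc' : ∀ j, c' j ∈ T')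
    (h : @IsRsopPart T _ hT₁ _ (fun j => (⟨c j, hc j⟩ : T))) : @IsRsopPart T' _ hT₂ _ (fun j => (⟨c' j, hc' j⟩ : T')) := by
  subst hT
  subst hcc
  exact h

variable {k K : Type} [Field k] [Field K] [Algebra k K]

/-- In a chain `Sq (i+1) = locAtCentre (closure (Sq i ∪ …)) Ō` (`i < n`) the rings increase: `Sq i ≤ Sq j` for `i ≤ j ≤ n`. [folklore] -/
theorem chain_mono {F : Type} [Field F] (Ō : ValuationSubring F) (Sq : ℕ → Subring F) (s : ℕ → ℕ) (zb : ℕ → ℕ → F) (n : ℕ)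
    (hstep : ∀ i < n, Sq (i + 1) =
      locAtCentre (Subring.closure ((Sq i : Set F) ∪ Set.range fun l : Fin (s i) => zb i l.succ / zb i 0)) Ō)
    {i j : ℕ} (hij : i ≤ j) (hj : j ≤ n) : Sq i ≤ Sq j := by
  induction j with
  | zero =>
    obtain rfl : i = 0 := Nat.le_zero.mp hij
    exact le_rfl
  | succ j ih =>
    rcases Nat.lt_or_ge i (j + 1) with hlt | hge
    · have h1 : Sq i ≤ Sq j := ih (Nat.lt_succ_iff.mp hlt) (Nat.le_of_succ_le hj)
      have h2 : Sq j ≤ Sq (j + 1) := by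
        rw [hstep j (Nat.lt_of_succ_le hj)]
        exact fun x hx => le_locAtCentre _ _ (Subring.subset_closure (Or.inl hx))
      exact h1.trans h2
    · obtain rfl : i = j + 1 := le_antisymm hij hge
      exact le_rfl

set_option maxHeartbeats 800000 in
-- one long assembly: the residue ring, CJS, the extra blow-up, the chain extraction and the read-off
/-- **The residue-side driver `CossartJannsenSaito2020Embedded → ResidueChains`.**  See the module docstring; the conclusion is VERBATIM the
hypothesis `hChains` of ✓ `localMonomialization_four_of_rankOne_of_residueChains` (for the given `O₁`, `A`, `W`), under the extra hypothesis
`dim A ≤ 4` (the assembly only ever calls it for models of `K/k` of dimension `≤ 4`).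
[cite: CossartJannsenSaito2020, Thm. 1.4 and Cor. 1.5 (p. 7)] [cite: NovacoskiSpivakovsky2014, Thm. 1.2 and §3.2] -/
theorem residueChains_of_cjs2020 (hCJS : CossartJannsenSaito2020Embedded.{0})
    (O O₁ : ValuationSubring K) (hO : O ≤ O₁) (hO₁ : O₁ ≠ ⊤)
    (A : Subalgebra k K) (hA : A.toSubring ≤ O.toSubring) (hAfg : A.FG) (hfrac : IsFractionRing A K)
    (hdimA : ringKrullDim A ≤ 4)
    (hreg : IsRegularLocalRing
      (Localization.AtPrime ((maximalIdeal O).comap (Subring.inclusion hA)) ⧸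
        ((maximalIdeal O₁).comap (Subring.inclusion (hA.trans hO))).map
          (algebraMap A.toSubring (Localization.AtPrime ((maximalIdeal O).comap (Subring.inclusion hA))))))
    (W : Finset K) (hW : ∀ w ∈ W, w ∈ A ∧ O₁.valuation w = 1) :
    ∃ (n : ℕ) (Sq : ℕ → Subring (ResidueField O₁)) (hSloc : ∀ i, IsLocalRing (Sq i)) (s : ℕ → ℕ)
      (zb : (i : ℕ) → Fin (s i + 1) → ResidueField O₁) (hzbS : ∀ i j, zb i j ∈ Sq i),
      ((residue O₁).comp (Subring.inclusion ((locAtCentre_le hA).trans hO))).range = Sq 0 ∧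
      (∀ i, i < n → (haveI := hSloc i; IsRsopPart (fun j : Fin (s i + 1) => (⟨zb i j, hzbS i j⟩ : Sq i)))) ∧
      (∀ i, i < n → (residueValuationSubring O O₁ hO).valuation (zb i 0) < 1) ∧
      (∀ i, i < n → ∀ l : Fin (s i),
        (residueValuationSubring O O₁ hO).valuation (zb i l.succ) ≤ (residueValuationSubring O O₁ hO).valuation (zb i 0)) ∧
      (∀ i, i < n → Sq (i + 1) =
        locAtCentre (Subring.closure ((Sq i : Set (ResidueField O₁)) ∪ Set.range fun l : Fin (s i) => zb i l.succ / zb i 0))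
          (residueValuationSubring O O₁ hO)) ∧
      ∃ (t : ℕ) (xb : Fin t → ResidueField O₁), (∀ i, xb i ∈ Sq n) ∧
        (∀ i, (residueValuationSubring O O₁ hO).valuation (xb i) < 1) ∧ (∀ i, xb i ≠ 0) ∧
        (∀ f ∈ Sq n, (residueValuationSubring O O₁ hO).valuation f < 1 →
          ∃ r : Fin t → ResidueField O₁, (∀ i, r i ∈ Sq n) ∧ f = ∑ i, r i * xb i) ∧
        IsRegularLocalRing (Sq n) ∧ ringKrullDim (Sq n) = (t : WithBot ℕ∞) ∧
        (∀ w : ResidueField O₁, ((∃ w' ∈ W, ∃ hw : w' ∈ O₁, residue O₁ ⟨w', hw⟩ = w) ∨ ∃ i < n, w = zb i 0) →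
          ∃ (ub : ResidueField O₁) (δ : Fin t → ℕ), ub ∈ Sq n ∧
            (residueValuationSubring O O₁ hO).valuation ub = 1 ∧ w = ub * ∏ i, xb i ^ δ i) := by
  classical
  haveI := hfrac
  set Ō := residueValuationSubring O O₁ hO with hŌdef
  have hAO₁ : A.toSubring ≤ O₁.toSubring := hA.trans hO
  have hLO : locAtCentre A.toSubring O ≤ O.toSubring := locAtCentre_le hA
  have hLO₁ : locAtCentre A.toSubring O ≤ O₁.toSubring := hLO.trans hO
  set ρ : locAtCentre A.toSubring O →+* ResidueField O₁ := (residue O₁).comp (Subring.inclusion hLO₁) with hρdef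
  set S : Subring (ResidueField O₁) := ρ.range with hSdef
  /- (1) `S ≅ A_𝔮/𝔭`: regular local, excellent -/
  haveI hfracSub : IsFractionRing A.toSubring K := isFractionRing_subalgebra_of_le A A le_rfl
  obtain ⟨θ, hθ⟩ := exists_centreResidueLift O O₁ hO A hA
  obtain ⟨e₁⟩ := nonempty_quotCentre_ringEquiv_range O O₁ hO A hA θ hθ
  have hθS : θ.range = S := range_centreResidueLift_eq_range_residue_locAtCentre O O₁ hO A hA θ hθ
  let eS := e₁.trans (RingEquiv.subringCongr hθS)
  haveI := hreg
  haveI hSreg : IsRegularLocalRing S :=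
    IsRegularLocalRing.of_ringEquiv
      (R := Localization.AtPrime ((maximalIdeal O).comap (Subring.inclusion hA)) ⧸
        ((maximalIdeal O₁).comap (Subring.inclusion (hA.trans hO))).map
          (algebraMap A.toSubring (Localization.AtPrime ((maximalIdeal O).comap (Subring.inclusion hA))))) eS
  haveI : Algebra.FiniteType k A := (Subalgebra.fg_iff_finiteType A).mp hAfg
  have hexcA : IsExcellentRing A := isExcellentRing_of_finiteType_field k A
  have hexcL : IsExcellentRing (Localization.AtPrime ((maximalIdeal O).comap (Subring.inclusion hA))) :=
    IsExcellentRing.of_isLocalization (A := A.toSubring) (B := Localization.AtPrime ((maximalIdeal O).comap (Subring.inclusion hA)))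
      ((maximalIdeal O).comap (Subring.inclusion hA)).primeCompl hexcA
  have hexcS : IsExcellentRing S :=
    IsExcellentRing.of_ringEquiv eS (IsExcellentRing.of_surjective (Ideal.Quotient.mk _) Ideal.Quotient.mk_surjective hexcL)
  /- (2) `S ⊆ Ō`, dominated -/
  have hSŌ : S ≤ Ō.toSubring := by
    rintro _ ⟨x, rfl⟩
    exact (residue_mem_residueValuationSubring_iff O O₁ hO _).mpr (hLO x.2)
  have hSeq : S = locAtCentre ((residue O₁).comp (Subring.inclusion hAO₁)).range Ō :=
    range_residue_locAtCentre O O₁ hO A.toSubring hA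
  have hSdom : locAtCentre S Ō = S := by
    conv_lhs => rw [hSeq]
    rw [locAtCentre_locAtCentre, ← hSeq]
  /- (3) the element `f = ∏ w̄` -/
  let wb : K → ResidueField O₁ := fun w => if h : w ∈ O₁ then residue O₁ ⟨w, h⟩ else 0
  have hwb : ∀ (w : K) (hw : w ∈ O₁), residue O₁ ⟨w, hw⟩ = wb w := fun w hw => by
    simp only [wb, dif_pos hw]
  have hwbS : ∀ w ∈ W, wb w ∈ S := fun w hw => by
    rw [← hwb w (hO (hA (hW w hw).1))]
    exact ⟨⟨w, le_locAtCentre _ _ (hW w hw).1⟩, rfl⟩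
  have hwb0 : ∀ w ∈ W, wb w ≠ 0 := fun w hw => by
    rw [← hwb w (hO (hA (hW w hw).1)), Ne, residue_eq_zero_iff]
    intro hm
    have h1 := (ValuationSubring.valuation_lt_one_iff O₁ _).mp hm
    change O₁.valuation w < 1 at h1
    rw [(hW w hw).2] at h1
    exact lt_irrefl _ h1
  let f : ResidueField O₁ := ∏ w ∈ W, wb w
  have hfS : f ∈ S := Subring.prod_mem _ fun w hw => hwbS w hw
  have hf0 : f ≠ 0 := Finset.prod_ne_zero_iff.mpr hwb0
  have hwbdvd : ∀ w ∈ W, f = wb w * ∏ w' ∈ W.erase w, wb w' := fun w hw => (Finset.mul_prod_erase W wb hw).symm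
  /- CASE A: `f` is a `ν̄`-unit — the trivial chain -/
  by_cases hvf : ¬ Ō.valuation f < 1
  · have hvf1 : Ō.valuation f = 1 := le_antisymm ((Ō.valuation_le_one_iff _).mpr (hSŌ hfS)) (not_lt.mp hvf)
    -- a regular system of parameters of `S`
    obtain ⟨sg, hsgcard, hsgspan⟩ := Submodule.FG.exists_span_finset_card_eq_spanFinrank (maximalIdeal S).fg_of_isNoetherianRing
    let c : Fin sg.card → S := fun i => (sg.equivFin.symm i : S)
    have hcrange : Set.range c = (sg : Set S) := by
      ext a
      constructor
      · rintro ⟨i, rfl⟩; exact (sg.equivFin.symm i).2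
      · intro ha; exact ⟨sg.equivFin ⟨a, ha⟩, by simp [c]⟩
    have hspan : Ideal.span (Set.range c ∪ Set.range (Fin.elim0 : Fin 0 → S)) = maximalIdeal S := by
      rw [Set.range_eq_empty Fin.elim0, Set.union_empty, hcrange]
      exact hsgspan
    have hdim : ringKrullDim S = (sg.card + 0 : ℕ) := by
      rw [Nat.add_zero, hsgcard, IsRegularLocalRing.spanFinrank_maximalIdeal]
    obtain ⟨t, xb, hxbS, hxb1, hxb0, hgen, hregS, hdimS, -⟩ :=
      readOff_of_monomial_form Ō S.subtype Subtype.val_injective S (Subring.range_subtype S) hSŌ hSdom c Fin.elim0 hdim hspan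
        1 1 0 isUnit_one (by simp)
    refine ⟨0, fun _ => S, fun _ => inferInstance, fun _ => 0, fun _ _ => 0, fun _ _ => S.zero_mem, rfl,
      fun i hi => absurd hi (Nat.not_lt_zero i), fun i hi => absurd hi (Nat.not_lt_zero i),
      fun i hi => absurd hi (Nat.not_lt_zero i), fun i hi => absurd hi (Nat.not_lt_zero i),
      t, xb, hxbS, hxb1, hxb0, hgen, hregS, hdimS, ?_⟩
    rintro w (⟨w', hw', hwO₁, rfl⟩ | ⟨i, hi, -⟩)
    · refine ⟨residue O₁ ⟨w', hwO₁⟩, 0, ?_, ?_, by simp⟩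
      · rw [hwb w' hwO₁]; exact hwbS w' hw'
      · -- each factor of the unit `f` is a unit
        rw [hwb w' hwO₁]
        refine le_antisymm ((Ō.valuation_le_one_iff _).mpr (hSŌ (hwbS w' hw'))) ?_
        by_contra hlt
        push Not at hlt
        have hle : Ō.valuation (∏ w'' ∈ W.erase w', wb w'') ≤ 1 :=
          (Ō.valuation_le_one_iff _).mpr (hSŌ (Subring.prod_mem _ fun w'' hw'' => hwbS w'' (Finset.mem_of_mem_erase hw'')))
        have : Ō.valuation f < 1 := by
          rw [hwbdvd w' hw', map_mul]
          calc Ō.valuation (wb w') * Ō.valuation (∏ w'' ∈ W.erase w', wb w'') < 1 * 1 :=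
                mul_lt_mul_of_lt_of_le_of_nonneg_of_pos hlt hle zero_le zero_lt_one
            _ = 1 := one_mul _
        exact hvf this
    · exact absurd hi (Nat.not_lt_zero i)
  push Not at hvf
  /- CASE B: `f ∈ 𝔪_S` — run CJS on `V(f) ⊂ Spec S` -/
  haveI : IsDomain (CommRingCat.of S) := inferInstanceAs (IsDomain S)
  haveI : IsNoetherianRing (CommRingCat.of S) := inferInstanceAs (IsNoetherianRing S)
  haveI : IsRegularRing (CommRingCat.of S) := isRegularRing_of_isRegularLocalRing S
  have hregZ : Scheme.IsRegular (Spec (.of S)) := Scheme.isRegular_Spec (.of S)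
  have hexcZ : Scheme.IsExcellent (Spec (.of S)) := Scheme.isExcellent_Spec_of_isExcellentRing S hexcS
  let fS : S := ⟨f, hfS⟩
  have hfS0 : fS ≠ 0 := fun h0 => hf0 (congrArg Subtype.val h0)
  have hdomS : ∀ a : S, a ∈ maximalIdeal S ↔ Ō.valuation (a : ResidueField O₁) < 1 := fun a =>
    mem_maximalIdeal_iff_of_range_eq_locAtCentre Ō S.subtype Subtype.val_injective hSŌ
      ((Subring.range_subtype S).trans hSdom.symm) a
  have hfSm : fS ∈ maximalIdeal S := (hdomS fS).mpr hvf
  -- `dim S ≤ 3`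
  have hdimS3 : ringKrullDim S ≤ 3 := by
    set 𝔮 := (maximalIdeal O).comap (Subring.inclusion hA) with h𝔮
    set 𝔭 := (maximalIdeal O₁).comap (Subring.inclusion hAO₁) with h𝔭
    -- `𝔭 ≠ 0`
    have h𝔭bot : 𝔭 ≠ ⊥ := by
      intro hP0
      apply hO₁
      ext z
      simp only [ValuationSubring.mem_top, iff_true]
      obtain ⟨a, b, hb, rfl⟩ := IsFractionRing.div_surjective (A := A.toSubring) z
      have hb0 : b ≠ 0 := nonZeroDivisors.ne_zero hb
      have hbP : b ∉ 𝔭 := by rw [hP0]; exact hb0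
      have hb1 : O₁.valuation (b : K) = 1 := by
        refine le_antisymm ((O₁.valuation_le_one_iff _).mpr (hAO₁ b.2)) (not_lt.mp fun hlt' => hbP ?_)
        rw [h𝔭, Ideal.mem_comap]
        exact (ValuationSubring.valuation_lt_one_iff O₁ _).mpr hlt'
      change (a : K) / (b : K) ∈ O₁
      rw [div_eq_mul_inv]
      refine mul_mem (hAO₁ a.2) ?_
      rw [← O₁.valuation_le_one_iff, map_inv₀, hb1, inv_one]
    obtain ⟨b, hb𝔭, hb0⟩ := Submodule.exists_mem_ne_zero_of_ne_bot h𝔭bot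
    set L := Localization.AtPrime 𝔮 with hL
    have hLdim : ringKrullDim L ≤ 4 := by
      rw [IsLocalization.AtPrime.ringKrullDim_eq_height 𝔮 L]
      exact (Ideal.height_le_ringKrullDim_of_isPrime (I := 𝔮)).trans hdimA
    have hbL0 : algebraMap A.toSubring L b ≠ 0 := fun h0 =>
      hb0 (IsLocalization.injective L (Ideal.primeCompl_le_nonZeroDivisors 𝔮) (by rw [h0, map_zero]))
    have h1 : ringKrullDim (L ⧸ Ideal.span {algebraMap A.toSubring L b}) + 1 ≤ ringKrullDim L :=
      ringKrullDim_quotient_succ_le_of_nonZeroDivisor (mem_nonZeroDivisors_of_ne_zero hbL0)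
    have h2 : ringKrullDim (L ⧸ 𝔭.map (algebraMap A.toSubring L)) ≤ ringKrullDim (L ⧸ Ideal.span {algebraMap A.toSubring L b}) :=
      ringKrullDim_le_of_surjective (Ideal.Quotient.factor ((Ideal.span_singleton_le_iff_mem _).mpr (Ideal.mem_map_of_mem _ hb𝔭)))
        (Ideal.Quotient.factor_surjective _)
    have h3 : ringKrullDim S = ringKrullDim (L ⧸ 𝔭.map (algebraMap A.toSubring L)) := (ringKrullDim_eq_of_ringEquiv eS).symm
    obtain ⟨dS, hdS⟩ := exists_nat_cast_eq_ringKrullDim (R := S)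
    rw [hdS] at h3 ⊢
    rw [← h3] at h2
    have h4 : (dS : WithBot ℕ∞) + 1 ≤ 4 := (((add_le_add h2 le_rfl).trans h1).trans hLdim)
    have h5 : dS + 1 ≤ 4 := by exact_mod_cast h4
    exact_mod_cast (show dS ≤ 3 by omega)
  have hmne : maximalIdeal S ≠ ⊥ := fun h => hfS0 (by rw [h, Ideal.mem_bot] at hfSm; exact hfSm)
  obtain ⟨m, hm2, hdimS⟩ := exists_ringKrullDim_eq_succ_of_le_three hdimS3 hmne
  -- the closed set `V(f)`
  let Xs₀ : Set (PrimeSpectrum S) := PrimeSpectrum.zeroLocus ({fS} : Set S)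
  let Xs : Set (Spec (.of S)) := Xs₀
  have hXs : ∀ p : PrimeSpectrum S, (p : Spec (.of S)) ∈ Xs ↔ fS ∈ p.asIdeal := fun p => by
    change p ∈ PrimeSpectrum.zeroLocus ({fS} : Set S) ↔ _
    rw [PrimeSpectrum.mem_zeroLocus, Set.singleton_subset_iff]
    rfl
  have hXs_eq : Xs = {p : Spec (.of S) | fS ∈ (p : PrimeSpectrum S).asIdeal} := Set.ext fun p => hXs p
  have hXclosed : IsClosed Xs := PrimeSpectrum.isClosed_zeroLocus _
  have hXdim : topologicalKrullDim Xs ≤ 2 :=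
    (topologicalKrullDim_zeroLocus_singleton_le hfS0 hfSm hdimS).trans (by exact_mod_cast hm2)
  /- (4) CJS Thm. 1.4 and the extra blow-up of the regular strict transform -/
  obtain ⟨Z₁, π₁, X₁, B₁, hT, hZ₁, hπ₁, -, -, hX₁reg, hB₁, htot, htr⟩ :=
    hCJS.of_isClosed (Spec (.of S)) hregZ hexcZ Xs hXclosed hXdim
  have hX₁ : IsClosed X₁ := hT.isClosed_transform hXclosed
  haveI : IsNoetherian Z₁ := by
    haveI : IsLocallyNoetherian Z₁ := LocallyOfFiniteType.isLocallyNoetherian π₁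
    haveI : CompactSpace Z₁ := QuasiCompact.compactSpace_of_compactSpace π₁
    exact {}
  have hcl : (⟨closure X₁, isClosed_closure⟩ : Closeds Z₁) = ⟨X₁, hX₁⟩ := Closeds.ext hX₁.closure_eq
  rw [hcl] at hX₁reg
  obtain ⟨Z₂, τ, hτ⟩ := exists_isBlowup Z₁ (vanishingIdeal ⟨X₁, hX₁⟩)
  obtain ⟨-, hsnc⟩ := htr.isStrictNormalCrossingsDivisor_preimage_of_isBlowup hZ₁ hX₁ hB₁ hτ
  have hT2 : π₁ '' ((vanishingIdeal (⟨X₁, hX₁⟩ : Closeds Z₁)).support : Set Z₁) ⊆ Xs := by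
    rw [Scheme.IdealSheafData.coe_support_vanishingIdeal]
    rintro _ ⟨z, hz, rfl⟩
    have : z ∈ π₁.base ⁻¹' Xs := by rw [htot]; exact Or.inl hz
    exact this
  have hIET2 := hT.blowup (vanishingIdeal (⟨X₁, hX₁⟩ : Closeds Z₁)) τ hτ hX₁reg hT2
  rw [hXs_eq] at hIET2
  /- (5) the chain along `ν̄` -/
  obtain ⟨-, -, hZ₂reg, x, ψ, hψ, hcompat, n, Sq, s, zb, hS0, hrange, hdomi, hrsop, hzb0, hmin, hstep, hfz⟩ :=
    chain_of_isEmbeddedTransform Ō S hSŌ hSdom hSreg f hfS hf0 _ hIET2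
  /- (6) the read-off at `x` -/
  have hsnc' : IsStrictNormalCrossingsDivisor Z₂
      ((τ ≫ π₁).base ⁻¹' {p : Spec (.of S) | fS ∈ (p : PrimeSpectrum S).asIdeal}) := by
    rw [← hXs_eq, Scheme.Hom.comp_base, TopCat.coe_comp, Set.preimage_comp, htot]
    exact hsnc
  set fg := Z₂.presheaf.germ ⊤ x trivial ((τ ≫ π₁).appTop ((Scheme.ΓSpecIso (.of S)).inv fS)) with hfgdef
  have hψfg : ψ fg = f := hcompat fS
  have hfg0 : fg ≠ 0 := fun h0 => hf0 (by rw [← hψfg, h0, map_zero])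
  have hSqn := hdomi n le_rfl
  have hdomx : ∀ a, a ∈ maximalIdeal (Z₂.presheaf.stalk x) ↔ Ō.valuation (ψ a) < 1 :=
    mem_maximalIdeal_iff_of_range_eq_locAtCentre Ō ψ hψ hSqn.1 (hrange.trans hSqn.2.symm)
  have hfgm : fg ∈ maximalIdeal _ := (hdomx fg).mpr (hψfg ▸ hvf)
  have hx : x ∈ (τ ≫ π₁).base ⁻¹' {p : Spec (.of S) | fS ∈ (p : PrimeSpectrum S).asIdeal} := by
    rw [Set.mem_preimage, Set.mem_setOf_eq]
    by_contra hxn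
    have h1 : (τ ≫ π₁).base x ∈ (Spec (.of S)).basicOpen ((Scheme.ΓSpecIso (.of S)).inv fS) := by
      rw [basicOpen_eq_of_affine]
      exact hxn
    have h2 : x ∈ Z₂.basicOpen ((τ ≫ π₁).appTop ((Scheme.ΓSpecIso (.of S)).inv fS)) := by
      rw [← Scheme.preimage_basicOpen_top]
      exact h1
    rw [Scheme.mem_basicOpen_top] at h2
    exact (IsLocalRing.mem_maximalIdeal _).mp hfgm h2
  haveI : IsRegularLocalRing (Z₂.presheaf.stalk x) := hZ₂reg x
  obtain ⟨r, e, xs, ys, u, α, -, -, hdim, hspan, hu, hfact⟩ :=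
    exists_germ_eq_isUnit_mul_prod_pow_of_isStrictNormalCrossingsDivisor (τ ≫ π₁) fS hsnc' hx hfg0
  obtain ⟨t, xb, hxbS, hxb1, hxb0, hgen, hregS, hdimSq, hdiv⟩ :=
    readOff_of_monomial_form Ō ψ hψ (Sq n) hrange hSqn.1 hSqn.2 xs ys hdim hspan fg u α hu hfact
  /- (7) packaging -/
  have hSloc' : ∀ i ≤ n, IsLocalRing (Sq i) := fun i hi => by
    obtain ⟨h1, h2⟩ := hdomi i hi
    rw [← h2]
    exact isLocalRing_locAtCentre h1
  let Sq' : ℕ → Subring (ResidueField O₁) := fun i => if i ≤ n then Sq i else Sq n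
  have hSq'le : ∀ i ≤ n, Sq' i = Sq i := fun i hi => if_pos hi
  have hSq'n : Sq' n = Sq n := if_pos le_rfl
  have hSloc : ∀ i, IsLocalRing (Sq' i) := fun i => by
    by_cases hi : i ≤ n
    · rw [show Sq' i = Sq i from if_pos hi]; exact hSloc' i hi
    · rw [show Sq' i = Sq n from if_neg hi]; exact hSloc' n le_rfl
  let zb' : ℕ → ℕ → ResidueField O₁ := fun i j => if i < n then zb i j else 0
  have hzb'lt : ∀ i < n, zb' i = zb i := fun i hi => funext fun j => if_pos hi
  have hzbS : ∀ (i : ℕ) (j : Fin (s i + 1)), zb' i j ∈ Sq' i := by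
    intro i j
    by_cases hi : i < n
    · obtain ⟨_, c, -, hc⟩ := hrsop i hi
      rw [hSq'le i hi.le]
      change (if i < n then zb i j else 0) ∈ Sq i
      rw [if_pos hi, ← hc j]
      exact (c j).2
    · change (if i < n then zb i j else 0) ∈ Sq' i
      rw [if_neg hi]
      exact (Sq' i).zero_mem
  have hmono : ∀ i ≤ n, Sq i ≤ Sq n := fun i hi => chain_mono Ō Sq s zb n hstep hi le_rfl
  refine ⟨n, Sq', hSloc, s, fun i (j : Fin (s i + 1)) => zb' i (j : ℕ), hzbS, ?_, ?_, ?_, ?_, ?_, t, xb, ?_, hxb1, hxb0, ?_, ?_, ?_, ?_⟩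
  · rw [hSq'le 0 (Nat.zero_le n)]; exact hS0.symm
  · intro i hi
    obtain ⟨hloci, c, hc, hcz⟩ := hrsop i hi
    have hcc : (fun j : Fin (s i + 1) => ((c j : Sq i) : ResidueField O₁)) = fun j : Fin (s i + 1) => zb' i (j : ℕ) := by
      funext j; rw [hcz j, hzb'lt i hi]
    exact isRsopPart_congr (hSq'le i hi.le).symm hcc (fun j => (c j).2) (fun j => hzbS i j) hc
  · intro i hi
    change Ō.valuation (if i < n then zb i 0 else 0) < 1
    rw [if_pos hi]; exact hzb0 i hi
  · intro i hi l
    change Ō.valuation (if i < n then zb i l.succ else 0) ≤ Ō.valuation (if i < n then zb i 0 else 0)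
    rw [if_pos hi, if_pos hi]
    exact hmin i hi l.succ (by rw [Fin.val_succ]; exact Nat.succ_le_of_lt l.2)
  · intro i hi
    change Sq' (i + 1) = locAtCentre (Subring.closure ((Sq' i : Set (ResidueField O₁)) ∪
      Set.range fun l : Fin (s i) => zb' i l.succ / zb' i 0)) Ō
    rw [hSq'le (i + 1) hi, hSq'le i hi.le, hzb'lt i hi]
    exact hstep i hi
  · intro i; rw [hSq'n]; exact hxbS i
  · intro f' hf' hvf'; rw [hSq'n] at hf' ⊢; exact hgen f' hf' hvf'
  · rw [hSq'n]; exact hregS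
  · rw [hSq'n]; exact hdimSq
  · rintro w (⟨w', hw', hwO₁, rfl⟩ | ⟨i, hi, rfl⟩)
    · -- residues of `w ∈ W` divide `f = ψ fg`
      rw [hSq'n, hwb w' hwO₁]
      have hS_le : S ≤ Sq n := hS0 ▸ hmono 0 (Nat.zero_le n)
      exact hdiv (wb w') (hS_le (hwbS w' hw'))
        ⟨∏ w'' ∈ W.erase w', wb w'', hS_le (Subring.prod_mem _ fun w'' hw'' => hwbS w'' (Finset.mem_of_mem_erase hw'')),
          by rw [hψfg]; exact hwbdvd w' hw'⟩
    · -- `z̄₀⁽ⁱ⁾` divides `f`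
      rw [hSq'n]
      change ∃ (ub : ResidueField O₁) (δ : Fin t → ℕ), ub ∈ Sq n ∧ Ō.valuation ub = 1 ∧ (if i < n then zb i 0 else 0) = ub * ∏ i, xb i ^ δ i
      rw [if_pos hi]
      obtain ⟨_, c, hc, hcz⟩ := hrsop i hi
      have hz0 : zb i 0 ≠ 0 := by
        intro h0
        refine hc.ne_zero 0 (Subtype.ext ?_)
        rw [hcz 0]
        exact h0
      exact hdiv (zb i 0) (hmono i hi.le (hcz 0 ▸ (c 0).2))
        ⟨f / zb i 0, hmono (i + 1) hi (hfz i hi), by rw [hψfg, mul_div_cancel₀ _ hz0]⟩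

end Summit.ResolutionOfSingularities.ResolutionOfSingularities.Theorems.RadicialJung.CleanModels

end
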